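import Literature.Geometry.Lorentzian.KerrConvergence
import Literature.Geometry.Lorentzian.KerrSchildEnergyEstimate
import HarnessLib

/-!
# Route ClusterCompleteness — crux `AdiabaticMultiKerrILED`, line `Sketch`: transport of leaf
# inequalities to the lab foliation (helpers for `stub_lateAssembly`)

Helper file for the crux `stmt-FinalStateConjecture-14310`
(`Summit.FinalStateConjecture.FinalStateConjecture.Theses.ClusterCompleteness.AdiabaticMultiKerrILED`),
line `Sketch`, serving the lead's assembly stub `stub_lateAssembly` (Dafermos–Rodnianski's red-shift
boundedness argument, arXiv:0811.0354 §3.3.4, run on the lab foliation of a boosted hole).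

* `leaf_to_lab_transport` — purely formal: an inequality between integrals over the graph leaves
  `{(σ + Fₐ(y'), y')}`, `Fₐ = s₁/u⁰ + F`, of three densities `g₁, g₂, g₃` (the shape of the red-shift
  estimate: `I₁(s) + ∫₀ˢ I₁ ≤ c' (I₂(0) + ∫₀ˢ I₃)`) becomes, through the slice/leaf change of variables
  `∫ g(q(t,y)) dy = J ∫ g(t/u⁰ + F(y'), y') dy'` and the time substitution `σ = (τ − s₁)/u⁰`, the
  lab-time inequality `A₁(s₂) + (1/u⁰)∫_{s₁}^{s₂} A₁ ≤ c' (A₂(s₁) + (1/u⁰)∫_{s₁}^{s₂} A₃)` for the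
  lab-slice integrals `A_k(τ) = ∫ g_k(q(τ,y)) dy`.
* `redshift_leaf_to_lab` — the same with the densities in the red-shift estimate's own format.
* `exists_pos_le_one_forall_mul_le` — a uniform collar parameter `0 < η ≤ 1`, `η Mᵢ ≤ bᵢ`.
* `lintegral_le_lintegral_add_sum_of_subset` — `∫_E f ≤ ∫_S f + Σᵢ ∫_{Cᵢ} f` when `E ⊆ S ∪ ⋃ᵢ Cᵢ`
  over a finite index type (splitting the exterior energy into the far part and the collars).
* `measurable_lintegral_comp_slice` — `τ ↦ ∫ g(q(τ,y)) dy` is measurable for measurable `g` and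
  continuous `q`.

Special-relativity/measure-theory folklore (O'Neill 1983, Ch. 9; Tonelli). [folklore]
-/

noncomputable section

-- the doubled `FinalStateConjecture.FinalStateConjecture` path component trips dupNamespace
set_option linter.dupNamespace false

open scoped ENNReal BigOperators
open Set MeasureTheory Literature.Geometry.Lorentzian

namespace Summit.FinalStateConjecture.FinalStateConjecture.Cruxes.AdiabaticMultiKerrILED.Sketch

/-- **Transport of a leaf inequality to the lab foliation.** Let `q` be the rest-frame map of a hole
with lab Lorentz factor `u0 > 0`, `F` the linear height of its leaves and `J` the Jacobian, so
that `∫ g(q(t,y)) dy = J ∫ g(t/u0 + F(y'), y') dy'` for every `g ≥ 0` and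
`∫_{t₁}^{t₂} f((t − t₁)/u0) dt = u0 ∫_0^{(t₂−t₁)/u0} f`. If three densities `g₁ g₂ g₃ ≥ 0` satisfy,
along the leaves of the height `Fₐ = s₁/u0 + F`, the red-shift-shaped inequality
`I₁(s) + ∫_0^s I₁ ≤ c' (I₂(0) + ∫_0^s I₃)` for all `s ≥ 0` (`I_k(σ) = ∫ g_k(σ + Fₐ(y'), y') dy'`), then
the lab-slice integrals `A_k(τ) = ∫ g_k(q(τ, y)) dy` satisfy
`A₁(s₂) + (1/u0) ∫_{s₁}^{s₂} A₁ ≤ c' (A₂(s₁) + (1/u0) ∫_{s₁}^{s₂} A₃)` for `s₁ ≤ s₂`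
(O'Neill 1983, Ch. 9: Poincaré covariance; Fubini bookkeeping). [folklore] -/
theorem leaf_to_lab_transport {u0 J : ℝ} (hu0 : 0 < u0) {F : E3 → ℝ} {q : E4 → E4}
    (hSL2 : ∀ (g : E4 → ℝ≥0∞) (t : ℝ), ∫⁻ y : E3, g (q (E4.ofTimeSpace t y)) =
      ENNReal.ofReal J * ∫⁻ y' : E3, g (E4.ofTimeSpace (u0⁻¹ * t + F y') y'))
    (hSL3 : ∀ (f : ℝ → ℝ≥0∞) (t₁ t₂ : ℝ), t₁ ≤ t₂ →
      ∫⁻ t in Set.Ioc t₁ t₂, f (u0⁻¹ * (t - t₁)) =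
        ENNReal.ofReal u0 * ∫⁻ s in Set.Ioc 0 (u0⁻¹ * (t₂ - t₁)), f s)
    (g₁ g₂ g₃ : E4 → ℝ≥0∞) (c' : ℝ≥0∞) {s₁ s₂ : ℝ} (hs : s₁ ≤ s₂)
    (hleaf : ∀ s : ℝ, 0 ≤ s →
      (∫⁻ y' : E3, g₁ (E4.ofTimeSpace (s + (u0⁻¹ * s₁ + F y')) y')) +
          ∫⁻ σ in Set.Ioc 0 s, ∫⁻ y' : E3, g₁ (E4.ofTimeSpace (σ + (u0⁻¹ * s₁ + F y')) y') ≤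
        c' * ((∫⁻ y' : E3, g₂ (E4.ofTimeSpace (0 + (u0⁻¹ * s₁ + F y')) y')) +
          ∫⁻ σ in Set.Ioc 0 s, ∫⁻ y' : E3, g₃ (E4.ofTimeSpace (σ + (u0⁻¹ * s₁ + F y')) y'))) :
    (∫⁻ y : E3, g₁ (q (E4.ofTimeSpace s₂ y))) +
        ENNReal.ofReal u0⁻¹ * ∫⁻ τ in Set.Ioc s₁ s₂, ∫⁻ y : E3, g₁ (q (E4.ofTimeSpace τ y)) ≤
      c' * ((∫⁻ y : E3, g₂ (q (E4.ofTimeSpace s₁ y))) +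
        ENNReal.ofReal u0⁻¹ * ∫⁻ τ in Set.Ioc s₁ s₂, ∫⁻ y : E3, g₃ (q (E4.ofTimeSpace τ y))) := by
  have hu0' : u0 ≠ 0 := hu0.ne'
  set s : ℝ := u0⁻¹ * (s₂ - s₁) with hs_def
  have hs0 : 0 ≤ s := mul_nonneg (inv_nonneg.mpr hu0.le) (sub_nonneg.mpr hs)
  -- the lab-slice integral at time `s₁ + u0 σ` is `J` times the leaf integral at parameter `σ`
  have hslice : ∀ (g : E4 → ℝ≥0∞) (σ : ℝ), ∫⁻ y : E3, g (q (E4.ofTimeSpace (s₁ + u0 * σ) y)) =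
      ENNReal.ofReal J * ∫⁻ y' : E3, g (E4.ofTimeSpace (σ + (u0⁻¹ * s₁ + F y')) y') := by
    intro g σ
    rw [hSL2 g (s₁ + u0 * σ)]
    congr 1
    refine lintegral_congr fun y' ↦ ?_
    congr 2
    field_simp
    ring
  -- the lab-time integral over `(s₁, s₂]` is `u0` times the leaf-parameter integral over `(0, s]`
  have htime : ∀ (g : E4 → ℝ≥0∞), ∫⁻ τ in Set.Ioc s₁ s₂, ∫⁻ y : E3, g (q (E4.ofTimeSpace τ y)) =
      ENNReal.ofReal u0 * (ENNReal.ofReal J *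
        ∫⁻ σ in Set.Ioc 0 s, ∫⁻ y' : E3, g (E4.ofTimeSpace (σ + (u0⁻¹ * s₁ + F y')) y')) := by
    intro g
    have h2 := hSL3 (fun σ ↦ ∫⁻ y : E3, g (q (E4.ofTimeSpace (s₁ + u0 * σ) y))) s₁ s₂ hs
    beta_reduce at h2
    rw [← hs_def] at h2
    calc ∫⁻ τ in Set.Ioc s₁ s₂, ∫⁻ y : E3, g (q (E4.ofTimeSpace τ y))
        = ∫⁻ τ in Set.Ioc s₁ s₂, ∫⁻ y : E3,
            g (q (E4.ofTimeSpace (s₁ + u0 * (u0⁻¹ * (τ - s₁))) y)) := by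
          refine lintegral_congr fun τ ↦ ?_
          congr 1
          funext y
          congr 3
          field_simp
          ring
      _ = ENNReal.ofReal u0 *
            ∫⁻ σ in Set.Ioc 0 s, ∫⁻ y : E3, g (q (E4.ofTimeSpace (s₁ + u0 * σ) y)) := h2
      _ = _ := by
          congr 1
          rw [← lintegral_const_mul' _ _ ENNReal.ofReal_ne_top]
          exact lintegral_congr fun σ ↦ hslice g σ
  -- rewrite the leaf inequality at `s` in lab variables
  have hmain := hleaf s hs0
  have hs₂ : s₁ + u0 * s = s₂ := by rw [hs_def]; field_simp; ring
  have hs₁ : s₁ + u0 * 0 = s₁ := by ring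
  have hA1 : ∫⁻ y : E3, g₁ (q (E4.ofTimeSpace s₂ y)) =
      ENNReal.ofReal J * ∫⁻ y' : E3, g₁ (E4.ofTimeSpace (s + (u0⁻¹ * s₁ + F y')) y') := by
    rw [← hs₂]; exact hslice g₁ s
  have hA2 : ∫⁻ y : E3, g₂ (q (E4.ofTimeSpace s₁ y)) =
      ENNReal.ofReal J * ∫⁻ y' : E3, g₂ (E4.ofTimeSpace (0 + (u0⁻¹ * s₁ + F y')) y') := by
    rw [← hslice g₂ 0, hs₁]
  have hcancel : ∀ X : ℝ≥0∞, ENNReal.ofReal u0⁻¹ * (ENNReal.ofReal u0 * X) = X := by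
    intro X
    rw [← mul_assoc, ← ENNReal.ofReal_mul (inv_nonneg.mpr hu0.le), inv_mul_cancel₀ hu0',
      ENNReal.ofReal_one, one_mul]
  rw [hA1, hA2, htime g₁, htime g₃, hcancel, hcancel, ← mul_add, ← mul_add, mul_left_comm]
  exact mul_le_mul' le_rfl hmain

/-- **The red-shift leaf inequality in lab variables.** Specialisation of `leaf_to_lab_transport` to
densities of the form `1_{P_k} e` written, along the leaves, in the format of the red-shift estimate
(`{y | P_k(σ + Fₐ(y), y)}`-indicators of `y ↦ e(σ + Fₐ(y), y)`): the conclusion is the lab-time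
inequality for the lab-slice integrals `∫ (1_{P_k} e)(q(τ, y)) dy` (O'Neill 1983, Ch. 9; Fubini
bookkeeping). [folklore] -/
theorem redshift_leaf_to_lab {u0 J : ℝ} (hu0 : 0 < u0) {F : E3 → ℝ} {q : E4 → E4}
    (hSL2 : ∀ (g : E4 → ℝ≥0∞) (t : ℝ), ∫⁻ y : E3, g (q (E4.ofTimeSpace t y)) =
      ENNReal.ofReal J * ∫⁻ y' : E3, g (E4.ofTimeSpace (u0⁻¹ * t + F y') y'))
    (hSL3 : ∀ (f : ℝ → ℝ≥0∞) (t₁ t₂ : ℝ), t₁ ≤ t₂ →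
      ∫⁻ t in Set.Ioc t₁ t₂, f (u0⁻¹ * (t - t₁)) =
        ENNReal.ofReal u0 * ∫⁻ s in Set.Ioc 0 (u0⁻¹ * (t₂ - t₁)), f s)
    (P₁ P₂ P₃ : E4 → Prop) (e : E4 → ℝ≥0∞) (c' : ℝ≥0∞) {s₁ s₂ : ℝ} (hs : s₁ ≤ s₂)
    (hleaf : ∀ s : ℝ, 0 ≤ s →
      (∫⁻ y : E3, {y : E3 | P₁ (E4.ofTimeSpace (s + (u0⁻¹ * s₁ + F y)) y)}.indicator
            (fun y ↦ e (E4.ofTimeSpace (s + (u0⁻¹ * s₁ + F y)) y)) y) +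
          ∫⁻ σ in Set.Ioc 0 s, ∫⁻ y : E3,
            {y : E3 | P₁ (E4.ofTimeSpace (σ + (u0⁻¹ * s₁ + F y)) y)}.indicator
              (fun y ↦ e (E4.ofTimeSpace (σ + (u0⁻¹ * s₁ + F y)) y)) y ≤
        c' * ((∫⁻ y : E3, {y : E3 | P₂ (E4.ofTimeSpace (0 + (u0⁻¹ * s₁ + F y)) y)}.indicator
              (fun y ↦ e (E4.ofTimeSpace (0 + (u0⁻¹ * s₁ + F y)) y)) y) +
          ∫⁻ σ in Set.Ioc 0 s, ∫⁻ y : E3,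
            {y : E3 | P₃ (E4.ofTimeSpace (σ + (u0⁻¹ * s₁ + F y)) y)}.indicator
              (fun y ↦ e (E4.ofTimeSpace (σ + (u0⁻¹ * s₁ + F y)) y)) y)) :
    (∫⁻ y : E3, {z : E4 | P₁ z}.indicator e (q (E4.ofTimeSpace s₂ y))) +
        ENNReal.ofReal u0⁻¹ *
          ∫⁻ τ in Set.Ioc s₁ s₂, ∫⁻ y : E3, {z : E4 | P₁ z}.indicator e (q (E4.ofTimeSpace τ y)) ≤
      c' * ((∫⁻ y : E3, {z : E4 | P₂ z}.indicator e (q (E4.ofTimeSpace s₁ y))) +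
        ENNReal.ofReal u0⁻¹ *
          ∫⁻ τ in Set.Ioc s₁ s₂, ∫⁻ y : E3, {z : E4 | P₃ z}.indicator e (q (E4.ofTimeSpace τ y))) := by
  -- the red-shift format is the composition format `(1_{P} e) ∘ (leaf point)`
  have hfmt : ∀ (P : E4 → Prop) (σ : ℝ),
      ∫⁻ y : E3, {y : E3 | P (E4.ofTimeSpace (σ + (u0⁻¹ * s₁ + F y)) y)}.indicator
          (fun y ↦ e (E4.ofTimeSpace (σ + (u0⁻¹ * s₁ + F y)) y)) y =
        ∫⁻ y : E3, {z : E4 | P z}.indicator e (E4.ofTimeSpace (σ + (u0⁻¹ * s₁ + F y)) y) :=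
    fun P σ ↦ lintegral_congr fun y ↦
      Set.indicator_comp_right (fun y : E3 ↦ E4.ofTimeSpace (σ + (u0⁻¹ * s₁ + F y)) y)
  refine leaf_to_lab_transport hu0 hSL2 hSL3 ({z : E4 | P₁ z}.indicator e)
    ({z : E4 | P₂ z}.indicator e) ({z : E4 | P₃ z}.indicator e) c' hs fun s hs0 ↦ ?_
  have h := hleaf s hs0
  rw [hfmt P₁ s, hfmt P₂ 0] at h
  have h1 : ∫⁻ σ in Set.Ioc 0 s, ∫⁻ y : E3,
      {y : E3 | P₁ (E4.ofTimeSpace (σ + (u0⁻¹ * s₁ + F y)) y)}.indicator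
        (fun y ↦ e (E4.ofTimeSpace (σ + (u0⁻¹ * s₁ + F y)) y)) y =
      ∫⁻ σ in Set.Ioc 0 s, ∫⁻ y : E3,
        {z : E4 | P₁ z}.indicator e (E4.ofTimeSpace (σ + (u0⁻¹ * s₁ + F y)) y) :=
    lintegral_congr fun σ ↦ hfmt P₁ σ
  have h3 : ∫⁻ σ in Set.Ioc 0 s, ∫⁻ y : E3,
      {y : E3 | P₃ (E4.ofTimeSpace (σ + (u0⁻¹ * s₁ + F y)) y)}.indicator
        (fun y ↦ e (E4.ofTimeSpace (σ + (u0⁻¹ * s₁ + F y)) y)) y =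
      ∫⁻ σ in Set.Ioc 0 s, ∫⁻ y : E3,
        {z : E4 | P₃ z}.indicator e (E4.ofTimeSpace (σ + (u0⁻¹ * s₁ + F y)) y) :=
    lintegral_congr fun σ ↦ hfmt P₃ σ
  rw [h1, h3] at h
  exact h

/-- **A uniform collar parameter**: for finitely many positive `Mᵢ, bᵢ` there is `0 < η ≤ 1` with
`η Mᵢ ≤ bᵢ` for all `i` (`η = 1/(1 + Σᵢ Mᵢ/bᵢ)`). [folklore] -/
theorem exists_pos_le_one_forall_mul_le {N : ℕ} (M b : Fin N → ℝ) (hM : ∀ i, 0 < M i)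
    (hb : ∀ i, 0 < b i) : ∃ η : ℝ, 0 < η ∧ η ≤ 1 ∧ ∀ i, η * M i ≤ b i := by
  have hS : 0 ≤ ∑ j, M j / b j := Finset.sum_nonneg fun j _ ↦ (div_pos (hM j) (hb j)).le
  refine ⟨1 / (1 + ∑ j, M j / b j), by positivity, ?_, fun i ↦ ?_⟩
  · rw [div_le_one (by positivity)]
    linarith
  · have hi : M i / b i ≤ 1 + ∑ j, M j / b j := by
      have := Finset.single_le_sum (fun j _ ↦ (div_pos (hM j) (hb j)).le) (Finset.mem_univ i)
      linarith
    have hbi := hb i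
    rw [div_mul_eq_mul_div, one_mul, div_le_iff₀ (by positivity)]
    calc M i = M i / b i * b i := by field_simp
      _ ≤ (1 + ∑ j, M j / b j) * b i := by gcongr
      _ = b i * (1 + ∑ j, M j / b j) := by ring

/-- **Splitting an integral along a finite cover**: if `E ⊆ S ∪ ⋃ᵢ Cᵢ` (finitely many `Cᵢ`), then
`∫_E f ≤ ∫_S f + Σᵢ ∫_{Cᵢ} f` for every `f ≥ 0` (subadditivity of the outer Lebesgue integral; no
measurability needed). [folklore] -/
theorem lintegral_le_lintegral_add_sum_of_subset {α : Type*} [MeasurableSpace α] (μ : Measure α)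
    {ι : Type*} [Fintype ι] (E S : Set α) (C : ι → Set α) (hE : E ⊆ S ∪ ⋃ i, C i)
    (f : α → ℝ≥0∞) :
    ∫⁻ x in E, f x ∂μ ≤ (∫⁻ x in S, f x ∂μ) + ∑ i, ∫⁻ x in C i, f x ∂μ := by
  calc ∫⁻ x in E, f x ∂μ ≤ ∫⁻ x in S ∪ ⋃ i, C i, f x ∂μ := lintegral_mono_set hE
    _ ≤ (∫⁻ x in S, f x ∂μ) + ∫⁻ x in ⋃ i, C i, f x ∂μ := lintegral_union_le _ _ _
    _ ≤ (∫⁻ x in S, f x ∂μ) + ∑ i, ∫⁻ x in C i, f x ∂μ := by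
        gcongr
        exact (lintegral_iUnion_le _ _).trans_eq (tsum_fintype _)

/-- **Measurability of lab-slice integrals in the time variable**: for a measurable density `g ≥ 0`
on `ℝ⁴` and a continuous self-map `q` of `ℝ⁴` (a Poincaré map), `τ ↦ ∫ g(q(τ, y)) dy` is
measurable (Tonelli). [folklore] -/
theorem measurable_lintegral_comp_slice {g : E4 → ℝ≥0∞} (hg : Measurable g) {q : E4 → E4}
    (hq : Continuous q) : Measurable fun τ : ℝ ↦ ∫⁻ y : E3, g (q (E4.ofTimeSpace τ y)) := by
  have hc : Continuous fun z : ℝ × E3 ↦ q (E4.ofTimeSpace z.1 z.2) :=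
    hq.comp E4.continuous_ofTimeSpace_uncurry
  exact (hg.comp hc.measurable).lintegral_prod_right'

end Summit.FinalStateConjecture.FinalStateConjecture.Cruxes.AdiabaticMultiKerrILED.Sketch

end
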